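import Literature.NumberTheory.PAdicHodge.LubinTatePeriodBdR
import Literature.NumberTheory.PAdicHodge.BdRPlusLog
import Literature.NumberTheory.PAdicHodge.BdRPlusDVR
import HarnessLib

/-!
# The Lubin–Tate period in `ℂ_F`: `Ω = θ(t_π / t) ≠ 0` with `χ(σ)·σ(Ω) = χ_π(σ)·Ω`

Topic `Literature/NumberTheory/PAdicHodge`; THEOREMS ONLY; sequel of `LubinTatePeriodBdR` (the Lubin–Tate period
`t_π = λ_f(ι_𝒪 x_t) ∈ Fil¹ B_dR⁺ ∖ Fil²`, `σ t_π = χ_π(σ) t_π`) and `BdRPlusLog` (Fontaine's `t = log[ε] = ξ·(unit)`,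
`σ t = χ(σ) t`). Writing `t_π = ξ·y` and `t = ξ·w` (`w ∈ (B_dR⁺)^×`) in `B_dR⁺ = B_dR⁺(F)`, the element
**`Ω := θ(y)·θ(w)⁻¹ ∈ ℂ_F`** — the image of `t_π/t ∈ B_dR⁺` under `θ`, i.e. the Hodge–Tate period of the Lubin–Tate
character at the identity embedding (Colmez 1993 §I.2; Serre's "Ω_π", Tate 1967 §3.3 `ℂ_F(χ_π χ⁻¹)^{Γ_F} ≠ 0`) — satisfies

* `Ω ≠ 0` (`t_π ∉ Fil²`, `q = #k_F ≥ 3`), and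
* **`χ(σ)·σ(Ω) = χ_π(σ)·Ω`** for every `σ ∈ Γ_F` whose Lubin–Tate character value lies in the coefficient ring `𝒪_D`
  (`χ` the cyclotomic character through `ℤ_p ⊆ ℚ_p = K₀ ⊆ F ⊆ ℂ_F`, `χ_π(σ) ∈ 𝒪_F ⊆ F ⊆ ℂ_F`):
  ★★ `exists_lubinTateTheta`.

Ingredients: `galBdRPlus_of_symm_lubinTatePeriod` (the `B_dR⁺`-level law pulled back along `BdRPlusTop.of`),
`of_symm_lubinTatePeriod_not_mem_span_sq`, `ξ`-torsion-freeness (`eq_zero_of_xiBdR_mul_eq_zero`), `ker θ = (ξ)`,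
`θ ∘ σ = σ ∘ θ`, `θ ∘ (F ↪ B_dR⁺) = (F ⊆ ℂ_F)`, `θ ∘ (ℚ_p → B_dR⁺) = (ℚ_p ⊆ F ⊆ ℂ_F)`. No named facts, no `sorry`.
Langlands (GL₁, de Rham characters of a `p`-adic field): `Ω` is the period that conjugates the identity-embedding
Hodge–Tate part of `χ_π` to `χ`; with the unramified periods it yields the conjugate-embedding periods of `χ_π`.

## References
* P. Colmez, *Périodes des variétés abéliennes à multiplication complexe*, Ann. of Math. 138 (1993), §I.2. [Colmez1993]
* J. T. Tate, *p-divisible groups* (1967), §3.3 Thm. 2–3. [Tate1967]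
* J.-M. Fontaine, *Le corps des périodes p-adiques*, Astérisque 223 (1994), Exp. II §1.5.4–1.5.5. [FontaineAsterisque223III]
-/

noncomputable section

open Ideal Field WittVector ValuativeRel

namespace Literature.NumberTheory.PAdicHodge

open Literature.NumberTheory.GaloisRepresentations
open Literature.NumberTheory.GaloisRepresentations.IsNonarchimedeanLocalField
open Literature.NumberTheory.GaloisRepresentations.LubinTate

variable {F : Type} [Field F] [ValuativeRel F] [TopologicalSpace F] [IsNonarchimedeanLocalField F] [CharZero F]
  {p : ℕ} [Fact p.Prime] {hp : valuation F p < 1} (D : EisensteinRoot F p hp)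
  [Fact (¬ IsUnit (p : integerC F))] [IsAdicComplete (Ideal.span {(p : integerC F)}) (integerC F)]

namespace EisensteinRoot

variable {hθ : Function.Surjective (fontaineTheta (integerC F) p)} {π : 𝒪[F]}
  (hπ : (valuation F).IsUniformizer (π : F)) (hπD : (π : F) = D.root) (hpq : p ∣ residueFieldCard F)

/-! ## §1 The period in `B_dR⁺ = BDeRhamPlus`: `t_π ∈ (ξ) ∖ (ξ²)`, `σ t_π = χ_π(σ) t_π` -/

/-- `t_π ∈ ξ B_dR⁺`. [cite: Colmez1993, §I.2] -/
theorem of_symm_lubinTatePeriod_mem_span_xiBdR :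
    (BdRPlusTop.of F p).symm (lubinTatePeriod D hθ hπ hπD hpq) ∈ Ideal.span {(xiBdR : BDeRhamPlus (integerC F) p)} :=
  BdRPlusTop.mem_filOne_iff.1 (lubinTatePeriod_mem_filOne D hπ hπD hpq)

/-- `t_π ∉ ξ² B_dR⁺` (`q ≥ 3`). [cite: Colmez1993, §I.2] [cite: Tate1967, §3.3] -/
theorem of_symm_lubinTatePeriod_not_mem_span_sq (hq3 : 3 ≤ residueFieldCard F) :
    (BdRPlusTop.of F p).symm (lubinTatePeriod D hθ hπ hπD hpq) ∉ Ideal.span {(xiBdR : BDeRhamPlus (integerC F) p) ^ 2} := by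
  intro h
  apply lubinTatePeriod_not_mem_sq D hπ hπD hpq hq3 (hθ := hθ)
  rw [BdRPlusTop.ideal_eq, Ideal.span_singleton_pow]
  obtain ⟨c, hc⟩ := Ideal.mem_span_singleton.1 h
  refine Ideal.mem_span_singleton.2 ⟨BdRPlusTop.of F p c, ?_⟩
  rw [← map_pow, ← map_mul, ← hc, RingEquiv.apply_symm_apply]

/-- **`σ(t_π) = χ_π(σ)·t_π` in `B_dR⁺`** whenever `χ_π(σ) ∈ 𝒪_D` (`toInt a = χ_π(σ)`).
[cite: Colmez1993, §I.2] [cite: FontaineAsterisque223III, Exp. II §1.5.4] -/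
theorem galBdRPlus_of_symm_lubinTatePeriod (hA : IsLTRing (CoeffDisc.of D (AdjoinRoot.root D.poly)) (residueFieldCard F))
    (hf : IsLTSeries (CoeffDisc.of D (AdjoinRoot.root D.poly)) (residueFieldCard F)
      (ltSeries (CoeffDisc.of D (AdjoinRoot.root D.poly)) (residueFieldCard F)))
    (σ : absoluteGaloisGroup F) {a : CoeffDisc D} (ha : CoeffDisc.toInt D a = (lubinTateChar hπ σ : 𝒪[F])) :
    galBdRPlus σ ((BdRPlusTop.of F p).symm (lubinTatePeriod D hθ hπ hπD hpq)) =
      embBdRHom hp hθ (((lubinTateChar hπ σ : 𝒪[F]) : F)) * (BdRPlusTop.of F p).symm (lubinTatePeriod D hθ hπ hπD hpq) := by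
  apply (BdRPlusTop.of F p).injective
  rw [← BdRPlusTop.gal_of, RingEquiv.apply_symm_apply, gal_lubinTatePeriod_eq D hπ hπD hpq hA hf σ ha, map_mul,
    RingEquiv.apply_symm_apply]

/-! ## §2 `Ω = θ(t_π/t) ∈ ℂ_F` -/

/-- ★★ **The Lubin–Tate period in `ℂ_F`.** For `q = #k_F ≥ 3` there is `Ω ∈ ℂ_F`, `Ω ≠ 0`, with
**`χ(σ)·σ(Ω) = χ_π(σ)·Ω`** for every `σ ∈ Γ_F` whose Lubin–Tate character value lies in `𝒪_D` — namely `Ω = θ(y)/θ(w)`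
where `t_π = ξ y`, `t = ξ w` in `B_dR⁺` (`Ω = θ(t_π/t)`): the Hodge–Tate period of `χ_π χ⁻¹` at the identity embedding
(`ℂ_F(χ_π χ⁻¹)^{Γ_F} ≠ 0`). [cite: Colmez1993, §I.2] [cite: Tate1967, §3.3 Thm. 2] [cite: FontaineAsterisque223III, Exp. II §1.5.5] -/
theorem exists_lubinTateTheta (hθ : Function.Surjective (fontaineTheta (integerC F) p)) (hπD : (π : F) = D.root)
    (hpq : p ∣ residueFieldCard F) (hq3 : 3 ≤ residueFieldCard F)
    (hA : IsLTRing (CoeffDisc.of D (AdjoinRoot.root D.poly)) (residueFieldCard F))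
    (hf : IsLTSeries (CoeffDisc.of D (AdjoinRoot.root D.poly)) (residueFieldCard F)
      (ltSeries (CoeffDisc.of D (AdjoinRoot.root D.poly)) (residueFieldCard F))) :
    ∃ Ω : CompletedAlgClosure F, Ω ≠ 0 ∧ ∀ σ : absoluteGaloisGroup F, ∀ a : CoeffDisc D,
      CoeffDisc.toInt D a = (lubinTateChar hπ σ : 𝒪[F]) →
        algebraMap F (CompletedAlgClosure F) (algebraMap (PadicBase F p hp) F ((PadicBase.toPadic hp).symm
            (((GaloisRep.cyclotomicCharacter F p σ : ℤ_[p]ˣ) : ℤ_[p]) : ℚ_[p]))) * (σ • Ω) =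
          algebraMap F (CompletedAlgClosure F) ((lubinTateChar hπ σ : 𝒪[F]) : F) * Ω := by
  set T : BDeRhamPlus (integerC F) p := (BdRPlusTop.of F p).symm (lubinTatePeriod D hθ hπ hπD hpq) with hT
  obtain ⟨y, hy⟩ := Ideal.mem_span_singleton.1 (of_symm_lubinTatePeriod_mem_span_xiBdR D hπ hπD hpq (hθ := hθ))
  obtain ⟨w, hw, htw⟩ := exists_tBdR_eq_xiBdR_mul (F := F) (p := p) hθ
  rw [← hT] at hy
  -- `θ(y) ≠ 0` (else `t_π ∈ ξ²`), `θ(w) ≠ 0` (`w` a unit)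
  have hθy : thetaBdR y ≠ 0 := by
    intro h0
    obtain ⟨y', hy'⟩ := Ideal.mem_span_singleton.1 ((mem_ker_thetaBdR_iff y).1 h0)
    apply of_symm_lubinTatePeriod_not_mem_span_sq D hπ hπD hpq hq3 (hθ := hθ)
    rw [← hT, hy, hy', ← mul_assoc, ← pow_two]
    exact Ideal.mem_span_singleton.2 ⟨y', rfl⟩
  have hθw : thetaBdR w ≠ 0 := (hw.map thetaBdR).ne_zero
  refine ⟨thetaBdR y * (thetaBdR w)⁻¹, mul_ne_zero hθy (inv_ne_zero hθw), fun σ a ha => ?_⟩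
  have hσw : σ • thetaBdR w ≠ 0 := fun h => hθw ((smul_eq_zero_iff_eq σ).1 h)
  -- the two `Γ_F`-laws in `B_dR⁺`
  have h1 : galBdRPlus σ xiBdR * galBdRPlus σ y = embBdRHom hp hθ (((lubinTateChar hπ σ : 𝒪[F]) : F)) * (xiBdR * y) := by
    rw [← map_mul, ← hy, hT]
    exact galBdRPlus_of_symm_lubinTatePeriod D hπ hπD hpq hA hf σ ha
  have h2 : galBdRPlus σ xiBdR * galBdRPlus σ w =
      qpToBdR (((GaloisRep.cyclotomicCharacter F p σ : ℤ_[p]ˣ) : ℤ_[p]) : ℚ_[p]) * (xiBdR * w) := by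
    rw [← map_mul, ← htw]
    exact galBdRPlus_tBdR σ
  -- cross-multiplication, cancelling `ξ`
  have h3 : embBdRHom hp hθ (((lubinTateChar hπ σ : 𝒪[F]) : F)) * y * galBdRPlus σ w =
      qpToBdR (((GaloisRep.cyclotomicCharacter F p σ : ℤ_[p]ˣ) : ℤ_[p]) : ℚ_[p]) * w * galBdRPlus σ y := by
    refine eq_of_sub_eq_zero (eq_zero_of_xiBdR_mul_eq_zero (F := F) (p := p) ?_)
    calc (xiBdR : BDeRhamPlus (integerC F) p) * (embBdRHom hp hθ (((lubinTateChar hπ σ : 𝒪[F]) : F)) * y * galBdRPlus σ w -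
          qpToBdR (((GaloisRep.cyclotomicCharacter F p σ : ℤ_[p]ˣ) : ℤ_[p]) : ℚ_[p]) * w * galBdRPlus σ y)
        = embBdRHom hp hθ (((lubinTateChar hπ σ : 𝒪[F]) : F)) * (xiBdR * y) * galBdRPlus σ w -
          qpToBdR (((GaloisRep.cyclotomicCharacter F p σ : ℤ_[p]ˣ) : ℤ_[p]) : ℚ_[p]) * (xiBdR * w) * galBdRPlus σ y := by
          ring
      _ = galBdRPlus σ xiBdR * galBdRPlus σ y * galBdRPlus σ w - galBdRPlus σ xiBdR * galBdRPlus σ w * galBdRPlus σ y := by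
          rw [← h1, ← h2]
      _ = 0 := by ring
  -- apply `θ`
  have h4 := congrArg thetaBdR h3
  simp only [map_mul, thetaBdR_galBdRPlus, thetaBdR_embBdRHom, thetaBdR_qpToBdR hp] at h4
  rw [smul_mul', smul_inv'']
  field_simp
  linear_combination -h4

end EisensteinRoot

end Literature.NumberTheory.PAdicHodge

end
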